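import Mathlib
import Literature.Analysis.ODE.StepChain
import Literature.Analysis.ODE.HighOrderEnclosureIntervalTest
import Literature.Analysis.ODE.SmoothFieldTaylorCoefficients
import Literature.Analysis.ODE.SmoothFieldIntervalTest
import Literature.Analysis.ODE.HighOrderEnclosureOpenDomain
import HarnessLib

/-!
# A chain of high-order enclosure steps for a field defined on an open domain

`Literature.Analysis.ODE.solution_mem_of_highOrderChain` (`StepChain.lean`; Nedialkov–Jackson–
Pryce 2001 §3 chained step after step, Moore 1979 §8.1 (8.13) "continue the solution") proves
that the transcript of a validated Taylor integrator — per step `j` an a-priori box `S j`, the HOE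
inclusion and the landing inclusion into the next admissible set `W (j+1)` — encloses EVERY
solution issued from `W 0` over the whole grid, under the growth hypothesis `hloc` (the field is
Lipschitz on all bounded sets).  With the uniqueness-along-one-solution argument of
`HighOrderEnclosureOpenDomain.lean` (Teschl 2012 §2.6) the growth hypothesis is replaced by a
Lipschitz condition near the a-priori boxes only, so that fields smooth on an open domain `Ω`
containing the boxes (quotients, logarithms, roots, powers — Moore 1979 §3.4 (3.19)) are covered:

* `solution_mem_of_highOrderChain_local` — `solution_mem_of_highOrderChain` with `hloc` replaced
  by "`f` is Lipschitz near every point of every `S j`";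
* `highOrderChain_smoothOn_local` — for `f ∈ C^∞(Ω; ℝ^ι)` and compact convex `S j ⊆ Ω`, with the
  Taylor coefficient maps `Φ_i = smoothTaylorMap hf i` of `SmoothFieldTaylorCoefficients.lean`:
  existence on `[0, τ N]` from every `y₀ ∈ W 0` and the enclosure of every solution, all analytic
  and growth hypotheses discharged;
* `highOrderChain_boxes_smoothOn_local` — the same from BOX DATA only: per step a step interval
  `T j ⊇ [0, h_j]`, boxes `W j`, `S j ⊆ Ω`, `V j`, `E j i` with `E j i ⊇ Φ_i(W j)` (`i < K`),
  `V j ⊇ Φ_K(S j)`, the HOE containment `∑_{i<K} (T j)^i · E j i + (T j)^K · V j ⊆ S j` and the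
  landing containment `∑_{i<K} [h_j, h_j]^i · E j i + [h_j, h_j]^K · V j ⊆ W (j+1)`
  (Moore 1979 §8.1 (8.10) at `t = t_{j+1}`; Nedialkov–Jackson–Corliss 1999 §5 Algorithm I):
  every solution from `W 0` passes through `W j` at `τ j` and lies in `S j` and in the interval
  Taylor polynomial over `[τ j, τ (j+1)]`.
-/

noncomputable section

open Set Metric Filter Topology NonemptyInterval TopologicalSpace

open scoped NNReal ContDiff

namespace Literature.Analysis.ODE

/-! ### The abstract chain with a local Lipschitz hypothesis -/

section HighOrder

variable {ι : Type*} [Fintype ι]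

/-- **A chain of high-order enclosure steps encloses EVERY solution — local form.**  Under the
hypotheses of `exists_solution_of_highOrderChain` (Taylor coefficient maps `Φ i` on the open
`Ω`, per step the a-priori box `S j ⊆ Ω`, the HOE inclusion and the landing inclusion), if `f`
is Lipschitz on some neighbourhood of every point of every `S j`, then every solution `y` of
`y' = f(y)` on `[0, τ N]` with `y 0 ∈ W 0` satisfies `y (τ j) ∈ W j` (`j ≤ N`) and, on
`[τ j, τ (j+1)]`, `y t ∈ S j` and `y t = ∑_{i<K} (t-τ j)^i • Φ i (y (τ j)) + (t-τ j)^K • v_t`,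
`v_t ∈ [c j, d j]` — `solution_mem_of_highOrderChain` with its growth hypothesis `hloc`
replaced by the local one (uniqueness along the enclosed solution, Teschl 2012 §2.6).
[cite: NedialkovJacksonPryce2001, §3 (HOE existence test)] [cite: Moore1979, §8.1 eq. (8.13)]
[cite: Teschl2012, §2.6 (uniqueness on the common interval, before Theorem 2.13)] -/
theorem solution_mem_of_highOrderChain_local {f : (ι → ℝ) → ι → ℝ}
    {Φ : ℕ → (ι → ℝ) → ι → ℝ} {Φ' : ℕ → (ι → ℝ) → ((ι → ℝ) →L[ℝ] (ι → ℝ))} {Ω : Set (ι → ℝ)}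
    {K : ℕ} (hK : 0 < K) {τ : ℕ → ℝ} {W S : ℕ → Set (ι → ℝ)} {L : ℕ → ℝ≥0} {B : ℕ → ℝ}
    {c d : ℕ → ι → ℝ} (N : ℕ) (hτ0 : τ 0 = 0) (hτ : ∀ j < N, τ j ≤ τ (j + 1))
    (hΦ0 : ∀ x, Φ 0 x = x) (hder : ∀ i < K, ∀ x ∈ Ω, HasFDerivAt (Φ i) (Φ' i x) x)
    (hrec : ∀ i < K, ∀ x ∈ Ω, Φ' i x (f x) = ((i : ℝ) + 1) • Φ (i + 1) x)
    (hSΩ : ∀ j < N, S j ⊆ Ω) (hbd : ∀ j < N, ∀ i < K, ∀ x ∈ S j, ‖Φ' i x‖ ≤ B j)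
    (hlipK : ∀ j < N, LipschitzOnWith (L j) (Φ K) (S j)) (hcd : ∀ j < N, c j ≤ d j)
    (hKS : ∀ j < N, MapsTo (Φ K) (S j) (Icc (c j) (d j)))
    (hincl : ∀ j < N, ∀ x ∈ W j, ∀ s ∈ Icc 0 (τ (j + 1) - τ j), ∀ v ∈ Icc (c j) (d j),
      (∑ i ∈ Finset.range K, s ^ i • Φ i x) + s ^ K • v ∈ S j)
    (hnext : ∀ j < N, ∀ x ∈ W j, ∀ v ∈ Icc (c j) (d j),
      (∑ i ∈ Finset.range K, (τ (j + 1) - τ j) ^ i • Φ i x) + (τ (j + 1) - τ j) ^ K • v ∈ W (j + 1))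
    (hfl : ∀ j < N, ∀ x ∈ S j, ∃ K' : ℝ≥0, ∃ U ∈ 𝓝 x, LipschitzOnWith K' f U)
    {y : ℝ → ι → ℝ} (hy0 : y 0 ∈ W 0)
    (hy : ∀ t ∈ Icc 0 (τ N), HasDerivWithinAt y (f (y t)) (Icc 0 (τ N)) t) :
    (∀ j ≤ N, y (τ j) ∈ W j) ∧
      ∀ j < N, ∀ t ∈ Icc (τ j) (τ (j + 1)), y t ∈ S j ∧ ∃ v ∈ Icc (c j) (d j),
        y t = (∑ i ∈ Finset.range K, (t - τ j) ^ i • Φ i (y (τ j))) + (t - τ j) ^ K • v := by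
  refine solution_mem_of_stepChain (W := W)
    (Q := fun j s x w => w ∈ S j ∧ ∃ v ∈ Icc (c j) (d j),
      w = (∑ i ∈ Finset.range K, s ^ i • Φ i x) + s ^ K • v) N hτ0 hτ
    (fun j hj x hx z hz0 hz s hs => ?_) (fun j hj x hx w hw => ?_) hy0 hy
  · exact solution_mem_of_highOrderEnclosure_local hK (hSΩ j hj) hΦ0 hder hrec (hbd j hj)
      (hlipK j hj) (hcd j hj) (hKS j hj) (sub_nonneg.2 (hτ j hj)) (hincl j hj x hx) (hfl j hj)
      hz0 hz hs
  · obtain ⟨-, v, hv, rfl⟩ := hw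
    exact hnext j hj x hx v hv

end HighOrder

/-! ### Smooth fields on an open domain -/

section Smooth

variable {ι : Type*} [Fintype ι] {Ω : Opens (ι → ℝ)} {f : (ι → ℝ) → ι → ℝ}

/-- **A chain of high-order enclosure steps for a field smooth on an open domain.**  Let
`f ∈ C^∞(Ω; ℝ^ι)`, `K ≥ 1`, a grid `0 = τ 0 ≤ … ≤ τ N`, and per step `j < N` an admissible set
`W j`, a compact convex a-priori box `S j ⊆ Ω` with `Φ_K(S j) ⊆ [c j, d j]`
(`Φ_i = smoothTaylorMap hf i`), the HOE inclusion
`∑_{i<K} s^i Φ_i(x) + s^K [c j, d j] ⊆ S j` (`x ∈ W j`, `s ∈ [0, h_j]`, `h_j = τ (j+1) - τ j`) and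
the landing inclusion `∑_{i<K} h_j^i Φ_i(x) + h_j^K [c j, d j] ⊆ W (j+1)`.  Then from every
`y₀ ∈ W 0` a solution of `y' = f(y)` exists on `[0, τ N]`, and EVERY solution `y` from `y₀`
satisfies `y (τ j) ∈ W j` (`j ≤ N`) and, on `[τ j, τ (j+1)]`, `y t ∈ S j` and
`y t = ∑_{i<K} (t-τ j)^i Φ_i(y (τ j)) + (t-τ j)^K v_t`, `v_t ∈ [c j, d j]` — every analytic
hypothesis of `exists_solution_of_highOrderChain` / `solution_mem_of_highOrderChain_local`
discharged by `SmoothFieldTaylorCoefficients.lean`, the local Lipschitz condition by smoothness.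
[cite: NedialkovJacksonPryce2001, §3 (HOE existence test)] [cite: Moore1979, §8.1 eq. (8.13)]
[cite: NedialkovJacksonCorliss1999, §5 Algorithm I]
[cite: Teschl2012, §2.6 (uniqueness on the common interval, before Theorem 2.13)] -/
theorem highOrderChain_smoothOn_local (hf : ContDiffOn ℝ ∞ f (Ω : Set (ι → ℝ))) {K : ℕ}
    (hK : 0 < K) {τ : ℕ → ℝ} {W S : ℕ → Set (ι → ℝ)} {c d : ℕ → ι → ℝ} (N : ℕ)
    (hτ0 : τ 0 = 0) (hτ : ∀ j < N, τ j ≤ τ (j + 1)) (hSΩ : ∀ j < N, S j ⊆ Ω)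
    (hS : ∀ j < N, IsCompact (S j)) (hSc : ∀ j < N, Convex ℝ (S j)) (hcd : ∀ j < N, c j ≤ d j)
    (hKS : ∀ j < N, MapsTo (smoothTaylorMap hf K) (S j) (Icc (c j) (d j)))
    (hincl : ∀ j < N, ∀ x ∈ W j, ∀ s ∈ Icc 0 (τ (j + 1) - τ j), ∀ v ∈ Icc (c j) (d j),
      (∑ i ∈ Finset.range K, s ^ i • smoothTaylorMap hf i x) + s ^ K • v ∈ S j)
    (hnext : ∀ j < N, ∀ x ∈ W j, ∀ v ∈ Icc (c j) (d j),
      (∑ i ∈ Finset.range K, (τ (j + 1) - τ j) ^ i • smoothTaylorMap hf i x)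
        + (τ (j + 1) - τ j) ^ K • v ∈ W (j + 1))
    {y₀ : ι → ℝ} (hy₀ : y₀ ∈ W 0) :
    (∃ y : ℝ → ι → ℝ, y 0 = y₀ ∧
        ∀ t ∈ Icc 0 (τ N), HasDerivWithinAt y (f (y t)) (Icc 0 (τ N)) t) ∧
      ∀ y : ℝ → ι → ℝ, y 0 = y₀ →
        (∀ t ∈ Icc 0 (τ N), HasDerivWithinAt y (f (y t)) (Icc 0 (τ N)) t) →
          (∀ j ≤ N, y (τ j) ∈ W j) ∧
            ∀ j < N, ∀ t ∈ Icc (τ j) (τ (j + 1)), y t ∈ S j ∧ ∃ v ∈ Icc (c j) (d j),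
              y t = (∑ i ∈ Finset.range K, (t - τ j) ^ i • smoothTaylorMap hf i (y (τ j)))
                + (t - τ j) ^ K • v := by
  have hB : ∀ j, ∃ B : ℝ, j < N → ∀ i < K, ∀ x ∈ S j, ‖smoothTaylorFDeriv hf i x‖ ≤ B := by
    intro j
    by_cases hj : j < N
    · obtain ⟨B, hB⟩ := exists_bound_smoothTaylorFDeriv hf K (hS j hj) (hSΩ j hj)
      exact ⟨B, fun _ => hB⟩
    · exact ⟨0, fun h => absurd h hj⟩
  choose B hB using hB
  have hL : ∀ j, ∃ L : ℝ≥0, j < N → LipschitzOnWith L (smoothTaylorMap hf K) (S j) := by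
    intro j
    by_cases hj : j < N
    · obtain ⟨L, hL⟩ := exists_lipschitzOnWith_smoothTaylorMap hf K (hS j hj) (hSc j hj) (hSΩ j hj)
      exact ⟨L, fun _ => hL⟩
    · exact ⟨0, fun h => absurd h hj⟩
  choose L hL using hL
  refine ⟨?_, fun y hy0 hy => solution_mem_of_highOrderChain_local hK N hτ0 hτ
    (smoothTaylorMap_zero hf) (fun i _ x hx => hasFDerivAt_smoothTaylorMap hf i hx)
    (fun i _ x hx => smoothTaylorFDeriv_apply_field hf i hx) hSΩ (fun j hj => hB j hj)
    (fun j hj => hL j hj) hcd hKS hincl hnext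
    (fun j hj x hx => exists_lipschitzOnWith_nhds_of_contDiffOn Ω.isOpen hf (hSΩ j hj hx))
    (hy0.symm ▸ hy₀) hy⟩
  obtain ⟨y, hy0, hy, -, -⟩ := exists_solution_of_highOrderChain hK N hτ0 hτ
    (smoothTaylorMap_zero hf) (fun i _ x hx => hasFDerivAt_smoothTaylorMap hf i hx)
    (fun i _ x hx => smoothTaylorFDeriv_apply_field hf i hx) hSΩ (fun j hj => hB j hj)
    (fun j hj => hL j hj) hcd hKS hincl hnext hy₀
  exact ⟨y, hy0, hy⟩

/-- **A chain of high-order enclosure steps from box data, field smooth on an open domain**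
(the transcript of an interval Taylor-series integrator, Moore 1979 §8.1; Nedialkov–Jackson–
Corliss 1999 §5 Algorithm I; validated step by step by the HOE test of Nedialkov–Jackson–Pryce
2001 §3).  Let `f ∈ C^∞(Ω; ℝ^ι)`, `K ≥ 1`, a grid `0 = τ 0 ≤ … ≤ τ N`, and per step `j < N`: a
step interval `T j ⊇ [0, h_j]` (`h_j = τ (j+1) - τ j`), boxes `W j`, `S j` with `boxSet (S j) ⊆ Ω`,
`V j`, `E j i`, sound enclosures `E j i ⊇ Φ_i(W j)` (`i < K`) and `V j ⊇ Φ_K(S j)`, the HOE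
containment `∑_{i<K} (T j)^i · E j i + (T j)^K · V j ⊆ S j` and the landing containment
`∑_{i<K} [h_j, h_j]^i · E j i + [h_j, h_j]^K · V j ⊆ W (j+1)`.  Then from every `y₀ ∈ W 0` a
solution exists on `[0, τ N]`, and EVERY solution `y` from `y₀` satisfies `y (τ j) ∈ W j`
(`j ≤ N`) and, for `t ∈ [τ j, τ (j+1)]`, `y t ∈ S j` and
`y t ∈ ∑_{i<K} (T j)^i · E j i + (T j)^K · V j` (Moore's interval Taylor polynomial (8.10)).
[cite: Moore1979, §8.1 eqs. (8.10), (8.13)] [cite: NedialkovJacksonCorliss1999, §5 Algorithm I]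
[cite: NedialkovJacksonPryce2001, §3 (HOE existence test)]
[cite: Teschl2012, §2.6 (uniqueness on the common interval, before Theorem 2.13)] -/
theorem highOrderChain_boxes_smoothOn_local (hf : ContDiffOn ℝ ∞ f (Ω : Set (ι → ℝ))) {K : ℕ}
    (hK : 0 < K) {τ : ℕ → ℝ} (N : ℕ) (hτ0 : τ 0 = 0) (hτ : ∀ j < N, τ j ≤ τ (j + 1))
    (T : ℕ → NonemptyInterval ℝ) (hT : ∀ j < N, ∀ t ∈ Icc 0 (τ (j + 1) - τ j), t ∈ T j)
    (W S V : ℕ → ι → NonemptyInterval ℝ) (E : ℕ → ℕ → ι → NonemptyInterval ℝ)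
    (hSΩ : ∀ j < N, boxSet (S j) ⊆ Ω)
    (hE : ∀ j < N, ∀ i < K, MapsTo (smoothTaylorMap hf i) (boxSet (W j)) (boxSet (E j i)))
    (hV : ∀ j < N, MapsTo (smoothTaylorMap hf K) (boxSet (S j)) (boxSet (V j)))
    (htest : ∀ j < N, hoeBox (T j) (E j) (V j) K ≤ S j)
    (hland : ∀ j < N, hoeBox (NonemptyInterval.pure (τ (j + 1) - τ j)) (E j) (V j) K ≤ W (j + 1))
    {y₀ : ι → ℝ} (hy₀ : y₀ ∈ boxSet (W 0)) :
    (∃ y : ℝ → ι → ℝ, y 0 = y₀ ∧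
        ∀ t ∈ Icc 0 (τ N), HasDerivWithinAt y (f (y t)) (Icc 0 (τ N)) t) ∧
      ∀ y : ℝ → ι → ℝ, y 0 = y₀ →
        (∀ t ∈ Icc 0 (τ N), HasDerivWithinAt y (f (y t)) (Icc 0 (τ N)) t) →
          (∀ j ≤ N, y (τ j) ∈ boxSet (W j)) ∧
            ∀ j < N, ∀ t ∈ Icc (τ j) (τ (j + 1)),
              y t ∈ boxSet (S j) ∧ y t ∈ boxSet (hoeBox (T j) (E j) (V j) K) := by
  have hmain := highOrderChain_smoothOn_local hf hK (W := fun j => boxSet (W j))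
    (S := fun j => boxSet (S j)) (c := fun j => boxLo (V j)) (d := fun j => boxHi (V j)) N hτ0 hτ
    hSΩ (fun j _ => isCompact_boxSet (S j)) (fun j _ => convex_boxSet (S j))
    (fun j _ => boxLo_le_boxHi (V j)) hV
    (fun j hj => hincl_of_hoeBox (hT j hj) (hE j hj) (htest j hj))
    (fun j hj x hx v hv => boxSet_mono (hland j hj)
      (taylorSum_mem_hoeBox (mem_pure_self _) (fun i hi => hE j hj i hi hx) hv)) hy₀
  refine ⟨hmain.1, fun y hy0 hy => ?_⟩
  obtain ⟨hyW, hyS⟩ := hmain.2 y hy0 hy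
  refine ⟨hyW, fun j hj t ht => ?_⟩
  obtain ⟨htS, v, hv, hyt⟩ := hyS j hj t ht
  refine ⟨htS, ?_⟩
  rw [hyt]
  exact taylorSum_mem_hoeBox (hT j hj (t - τ j) ⟨sub_nonneg.2 ht.1, sub_le_sub_right ht.2 _⟩)
    (fun i hi => hE j hj i hi (hyW j hj.le)) hv

end Smooth

end Literature.Analysis.ODE
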